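import Mathlib
import Summits.CriticalPhenomena.CardyFormulaZ2.Theorems.CardySelfRefinementGradientComparabilityStubJointCrossingNondegenerateTube
import Summits.CriticalPhenomena.CardyFormulaZ2.Theorems.CardySelfRefinementRussoDriftModel
import Literature.Probability.Percolation.IsoradialProofs
import Literature.Probability.Percolation.IsoradialArmExtension
import Literature.Probability.Percolation.RSWChainingInputs
import HarnessLib

/-!
# (D1) Non-degeneracy of the joint crossing event: RSW for quads and Harris–FKG

Crux `stmt-CriticalPhenomena-10269`
(`Summit.CriticalPhenomena.CardyFormulaZ2.Theses.CardySelfRefinement.GradientComparability`),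
line **Sketch**, stub `stub_jointCrossing_nondegenerate` (hypothesis (D1) of the Talagrand
composition `allEdgesPivotalSum_diverges`).  Vocabulary (`A`, `Aloc`, `nnSupport`, …) from
`CardySelfRefinementDefs` / `CardySelfRefinementRussoDriftModel`; the deterministic tube
construction is the registered sub-goal `stub_jointCrossing_tube` (helper file
`…StubJointCrossingNondegenerateTube`), packaged with the box events in `exists_tube_events`.

## Mathematics

For bond percolation on `ℤ²` at `p = ½` drawn at mesh `η` (`squareLatticeEmbedding.z`, i.e.
`δℤ²` with `δ = η√2`, Schramm–Smirnov `configOf` = closure of the raw crossed quads; on the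
full-measure set `nnSupport` of lattice configurations this is `z2QuadConfig`, whose membership
is "some crossing of the quad lies inside the drawn open edges",
`mem_z2QuadConfig_iff_exists_isCrossing`) and a nonempty finite quad family `F`:

* **lower bound.**  For each quad `F i` the helper file gives mesh-independent tube data: at every
  small mesh, open long-way crossings of `2(Nᵢ+1)` explicit rectangles of aspect ratio `8` and
  size `≈ sᵢ` force a crossing of `F i` inside the open edges.  Each rectangle is crossed with
  probability `≥ c` (the box-crossing property `square_boxCrossing_holds`, Russo–Seymour–Welsh),
  all these events are increasing, so by Harris–FKG (`harris_fkg_holds`) all quads are crossed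
  with probability `≥ ∏ᵢ c^{2(Nᵢ+1)}` (`eventually_tube`, `real_biInter_ge_prod`).
* **upper bound.**  Apply the same to the TRANSPOSED first quad (`Quad.exists_transpose`) and to
  the dual configuration: with probability `≥ c^{2(N+1)}` (self-duality
  `bondPercolation_map_dualConfig_holds`) the dual-open edges, drawn on `δℤ² + δ(½,½)`, contain a
  continuum in `[F 0]` joining `∂₁F 0` to `∂₃F 0`; it meets every open crossing of `F 0` (crossing
  lemma `Quad.exists_mem_of_isPreconnected_crossing'`, crossings inside open edges being path
  crossings, `joinedIn_inter_openEdgeUnion_of_isConnected`) at a point both on an open edge and on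
  a dual-open dual edge, impossible (`not_mem_openEdgeUnion_dualConfig_sub`).  So `F 0`, a fortiori
  the family, is crossed with probability `≤ 1 - c^{2(N+1)}`.
* `μ(Aloc) = μ(A ∩ nnSupport)` (`A_inter_nnSupport_eq`, `setBernoulli_ae_subset`).
-/

noncomputable section

namespace Summit.CriticalPhenomena.CardyFormulaZ2.Theorems.CardySelfRefinement

open scoped Topology
open Filter Set MeasureTheory
open Literature.Probability.LatticeModels Literature.Probability.Percolation
open Literature.Probability.Percolation.QuadCrossing
open Summit.CriticalPhenomena.CardyFormulaZ2.Theses.CardySelfRefinement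

/-! ## The tube events of a quad -/

/-- **The tube events of a quad.**  For every quad `Q` there are mesh-independent data
`N, P, s` such that, for every mesh `η` with `6η ≤ s`, every integer scale `n` with
`s - η < ηn ≤ s`, every shift `t` with `|re t|, |im t| ≤ 2η` and every lattice configuration `ω`:
if `ω` has open long-way crossings of the `2(N+1)` explicit translated `8n × n` / `n × 8n`
rectangles around the points `P_j` (events `embRectCrossing` / `embTBCrossing` of the drawing
`squareLatticeEmbedding.z`), then some crossing `K` of `Q` has `K - t` inside the open edges of
`ω` drawn at mesh `η√2` (`openEdgeUnion`). -/
theorem exists_tube_events (Q : Quad (univ : Set ℂ)) :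
    ∃ (N : ℕ) (P : ℕ → ℂ) (s : ℝ), 0 < s ∧
      ∀ η : ℝ, 0 < η → 6 * η ≤ s → ∀ n : ℕ, s - η < η * n → η * n ≤ s →
      ∀ t : ℂ, |t.re| ≤ 2 * η → |t.im| ≤ 2 * η →
      ∀ ω : BondConfig (Site 2), ω ⊆ (zdGraph 2).edgeSet →
        (∀ j ≤ N,
          ω ∈ embRectCrossing (fun v => squareLatticeEmbedding.z v -
            ⟨((P j).re - 3 * s - 2 * η) / η, ((P j).im - s + 2 * η) / η⟩) (8 * n) n ∧
          ω ∈ embTBCrossing (fun v => squareLatticeEmbedding.z v -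
            ⟨((P j).re - s + 2 * η) / η, ((P j).im - 3 * s - 2 * η) / η⟩) n (8 * n)) →
        ∃ K, Q.IsCrossing K ∧ ∀ z ∈ K, z - t ∈ openEdgeUnion (η * Real.sqrt 2) ω := by
  obtain ⟨N, P, s, hs, hP, htube⟩ := stub_jointCrossing_tube Q
  refine ⟨N, P, s, hs, fun η hη hηs n hn hn' t htr hti ω hω hbox => ?_⟩
  have hηne : η ≠ 0 := hη.ne'
  have HH : ∀ j ≤ N, ∃ C : Set ℂ, IsCompact C ∧ IsPreconnected C ∧
      C ⊆ Icc ((P j).re - 4 * s) ((P j).re + 6 * s) ×ℂ Icc ((P j).im - s) ((P j).im + s) ∧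
      (∀ z ∈ C, z - t ∈ openEdgeUnion (η * Real.sqrt 2) ω) ∧
      (∃ z ∈ C, z.re ≤ (P j).re - 3 * s) ∧ ∃ z ∈ C, (P j).re + 3 * s ≤ z.re := fun j hj =>
    boxH_continuum hη hηs hn hn' (P j) t htr hti (by simp only; field_simp)
      (by simp only; field_simp) hω (hbox j hj).1
  have HV : ∀ j ≤ N, ∃ C : Set ℂ, IsCompact C ∧ IsPreconnected C ∧
      C ⊆ Icc ((P j).re - s) ((P j).re + s) ×ℂ Icc ((P j).im - 4 * s) ((P j).im + 6 * s) ∧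
      (∀ z ∈ C, z - t ∈ openEdgeUnion (η * Real.sqrt 2) ω) ∧
      (∃ z ∈ C, z.im ≤ (P j).im - 3 * s) ∧ ∃ z ∈ C, (P j).im + 3 * s ≤ z.im := fun j hj =>
    boxV_continuum hη hηs hn hn' (P j) t htr hti (by simp only; field_simp)
      (by simp only; field_simp) hω (hbox j hj).2
  choose! Hc hHc hHp hHR hHO hHa hHb using HH
  choose! Vc hVc hVp hVR hVO hVa hVb using HV
  set GOOD : Set ℂ := {z | z - t ∈ openEdgeUnion (η * Real.sqrt 2) ω} with hGOOD
  obtain ⟨C, hCc, hCp, hCG, hCd, hC0, hCN⟩ := chain P GOOD Hc Vc N hP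
    (fun j hj => ⟨hHc j hj, hHp j hj, fun z hz => hHO j hj z hz, hHR j hj, hHa j hj, hHb j hj⟩)
    (fun j hj => ⟨hVc j hj, hVp j hj, fun z hz => hVO j hj z hz, hVR j hj, hVa j hj, hVb j hj⟩)
  obtain ⟨z0, hz0, -⟩ := hVa 0 (Nat.zero_le _)
  obtain ⟨zN, hzN, -⟩ := hHa N le_rfl
  obtain ⟨K, hK, hKG⟩ := htube GOOD C hCc hCp hCG hCd
    ⟨z0, hC0 hz0, dist_le_of_mem_boxes (Or.inr (hVR 0 (Nat.zero_le _) hz0))⟩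
    ⟨zN, hCN hzN, dist_le_of_mem_boxes (Or.inl (hHR N le_rfl hzN))⟩
  exact ⟨K, hK, fun z hz => hKG hz⟩

/-! ## The tube events of a quad have probability bounded below (RSW + FKG) -/

/-- **RSW for a quad, event form.**  For every quad `Q` there are increasing measurable events
`T η` of probability `≥ c₁ > 0` for all small meshes `η`, on which every lattice configuration
`ω` has, for every shift `t` with `|re t|, |im t| ≤ 2η`, a crossing `K` of `Q` with `K - t` inside
the open edges of `ω` drawn at mesh `η√2`.  (`T η` = open long-way crossings of the `2(N+1)`
rectangles of the tube of `Q` at the integer scale `⌊s/η⌋₊`; bound `c^{2(N+1)}` by the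
box-crossing property at aspect ratio `8` and Harris–FKG.) -/
theorem eventually_tube (Q : Quad (univ : Set ℂ)) :
    ∃ (T : ℝ → Set (BondConfig (Site 2))) (c₁ : ℝ), 0 < c₁ ∧
      ∀ᶠ η in 𝓝[>] (0 : ℝ), MeasurableSet (T η) ∧ IsUpperSet (T η) ∧
        c₁ ≤ (bondPercolation (zdGraph 2) half).real (T η) ∧
        ∀ t : ℂ, |t.re| ≤ 2 * η → |t.im| ≤ 2 * η → ∀ ω ∈ T η, ω ⊆ (zdGraph 2).edgeSet →
          ∃ K, Q.IsCrossing K ∧ ∀ z ∈ K, z - t ∈ openEdgeUnion (η * Real.sqrt 2) ω := by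
  obtain ⟨N, P, s, hs, hev⟩ := exists_tube_events Q
  obtain ⟨c, hc, n₀, hB⟩ := square_boxCrossing_holds 8 (by norm_num)
  set RH : ℝ → ℕ → Set (BondConfig (Site 2)) := fun η j =>
    embRectCrossing (fun v => squareLatticeEmbedding.z v -
      ⟨((P j).re - 3 * s - 2 * η) / η, ((P j).im - s + 2 * η) / η⟩)
      (8 * ⌊s / η⌋₊) ⌊s / η⌋₊ with hRH
  set RV : ℝ → ℕ → Set (BondConfig (Site 2)) := fun η j =>
    embTBCrossing (fun v => squareLatticeEmbedding.z v -
      ⟨((P j).re - s + 2 * η) / η, ((P j).im - 3 * s - 2 * η) / η⟩)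
      ⌊s / η⌋₊ (8 * ⌊s / η⌋₊) with hRV
  refine ⟨fun η => ⋂ j ∈ Finset.range (N + 1), (RH η j ∩ RV η j), (c * c) ^ (N + 1),
    by positivity, ?_⟩
  rw [eventually_nhdsWithin_iff, Metric.eventually_nhds_iff]
  refine ⟨min (s / 6) (s / (n₀ + 1)), by positivity, fun η hη hη0 => ?_⟩
  have hη0 : 0 < η := hη0
  rw [Real.dist_eq, sub_zero, abs_of_pos hη0, lt_min_iff, lt_div_iff₀ (by norm_num : (0:ℝ) < 6),
    lt_div_iff₀ (by positivity : (0:ℝ) < n₀ + 1)] at hη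
  have hηs : 6 * η ≤ s := by linarith [hη.1]
  have hfl := Nat.lt_floor_add_one (s / η)
  have hfl' := Nat.floor_le (div_nonneg hs.le hη0.le)
  rw [div_lt_iff₀ hη0] at hfl
  rw [le_div_iff₀ hη0] at hfl'
  have hn1 : s - η < η * ⌊s / η⌋₊ := by linarith
  have hn2 : η * ⌊s / η⌋₊ ≤ s := by linarith
  have hn0 : n₀ ≤ ⌊s / η⌋₊ := by
    have h2 : (n₀ : ℝ) < ⌊s / η⌋₊ := by
      by_contra hcon
      push Not at hcon
      have := mul_le_mul_of_nonneg_left hcon hη0.le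
      nlinarith [hη.2]
    exact_mod_cast h2.le
  have hmeas : ∀ j, MeasurableSet (RH η j ∩ RV η j) := fun j =>
    (IsoradialArmExtension.measurableSet_embRectCrossing _ _ _).inter
      (IsoradialArmExtension.measurableSet_embTBCrossing _ _ _)
  have hup : ∀ j, IsUpperSet (RH η j ∩ RV η j) := fun j =>
    (isUpperSet_embRectCrossing _ _ _).inter (isUpperSet_embTBCrossing _ _ _)
  refine ⟨(Finset.range (N + 1)).measurableSet_biInter fun j _ => hmeas j,
    isUpperSet_iInter₂ fun j _ => hup j, ?_, fun t htr hti ω hω hωE => ?_⟩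
  · calc (c * c) ^ (N + 1) = ∏ j ∈ Finset.range (N + 1), c * c := by simp
      _ ≤ ∏ j ∈ Finset.range (N + 1),
            (bondPercolation (zdGraph 2) half).real (RH η j ∩ RV η j) := by
          refine Finset.prod_le_prod (fun _ _ => by positivity) fun j _ => ?_
          have h1 := (hB _ hn0 ⟨((P j).re - 3 * s - 2 * η) / η, ((P j).im - s + 2 * η) / η⟩).1.1
          have h2 := (hB _ hn0 ⟨((P j).re - s + 2 * η) / η, ((P j).im - 3 * s - 2 * η) / η⟩).2.1
          calc c * c ≤ (bondPercolation (zdGraph 2) half).real (RH η j) *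
                (bondPercolation (zdGraph 2) half).real (RV η j) :=
                mul_le_mul h1 h2 hc.le measureReal_nonneg
            _ ≤ _ := harris_fkg_holds (zdGraph 2) half (isUpperSet_embRectCrossing _ _ _)
                (isUpperSet_embTBCrossing _ _ _)
                (IsoradialArmExtension.measurableSet_embRectCrossing _ _ _)
                (IsoradialArmExtension.measurableSet_embTBCrossing _ _ _)
      _ ≤ _ := real_biInter_ge_prod (zdGraph 2) half _ _ (fun j _ => hup j) (fun j _ => hmeas j)
  · refine hev η hη0 hηs _ hn1 hn2 t htr hti ω hωE fun j hj => ?_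
    exact mem_iInter₂.1 hω j (Finset.mem_range.2 (Nat.lt_succ_of_le hj))

/-! ## The stub -/

/-- **(D1) Non-degeneracy of the joint crossing event.**  For a nonempty finite quad family, the
`P_{1/2}`-probability that all quads are crossed at mesh `η` (localised event `Aloc`) stays in
`[c₀, 1 − c₀]` for all small meshes: RSW for quads + Harris–FKG for the lower bound, the same for
the dual lattice and the transposed first quad (self-duality at `½`, planar duality) for the
upper bound. -/
theorem stub_jointCrossing_nondegenerate :
    ∀ (m : ℕ) (F : Fin m → Quad (Set.univ : Set ℂ)), 0 < m →
      ∃ c₀ η₂ : ℝ, 0 < c₀ ∧ 0 < η₂ ∧ ∀ η ∈ Set.Ioo 0 η₂,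
        c₀ ≤ (bondPercolation (zdGraph 2) half).real (Aloc m F η) ∧
          (bondPercolation (zdGraph 2) half).real (Aloc m F η) ≤ 1 - c₀ := by
  intro m F hm
  -- primal tubes for every quad, dual tube for the transposed first quad
  choose T c hc hT using fun i => eventually_tube (F i)
  obtain ⟨Qt, hcar, ht0, -, ht2, -⟩ := (F ⟨0, hm⟩).exists_transpose
  obtain ⟨T', c', hc', hT'⟩ := eventually_tube Qt
  have hall := (eventually_all.2 hT).and hT'
  rw [eventually_nhdsWithin_iff, Metric.eventually_nhds_iff] at hall
  obtain ⟨ε, hε, hεall⟩ := hall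
  refine ⟨min (∏ i, c i) c', ε, lt_min (Finset.prod_pos fun i _ => hc i) hc', hε, fun η hη => ?_⟩
  have hη0 : 0 < η := hη.1
  obtain ⟨hprim, hT'm, -, hT'c, hK'⟩ :=
    hεall (by rw [Real.dist_eq, sub_zero, abs_of_pos hη0]; exact hη.2 : dist η 0 < ε) hη0
  have hδ : 0 < η * Real.sqrt 2 := by positivity
  -- the support and the crossing criterion on it
  have hN : bondPercolation (zdGraph 2) half nnSupportᶜ = 0 := by
    have h : bondPercolation (zdGraph 2) half {ω | ¬ ω ⊆ (zdGraph 2).edgeSet} = 0 :=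
      ae_iff.1 ProbabilityTheory.setBernoulli_ae_subset
    simpa [nnSupport, compl_setOf] using h
  have hAloc : (bondPercolation (zdGraph 2) half).real (Aloc m F η) =
      (bondPercolation (zdGraph 2) half).real (A m F η ∩ nnSupport) := by
    rw [measureReal_def, measureReal_def, ← measure_inter_conull (s := Aloc m F η) hN,
      ← A_inter_nnSupport_eq]
  have hcrit : ∀ ω ∈ nnSupport, ∀ Q : Quad (univ : Set ℂ),
      Q ∈ configOf squareLatticeEmbedding.z η univ ω ↔
        ∃ K, Q.IsCrossing K ∧ K ⊆ openEdgeUnion (η * Real.sqrt 2) ω := by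
    intro ω hω Q
    have e : configOf squareLatticeEmbedding.z η univ ω =
        z2QuadConfig univ (η * Real.sqrt 2) ω := by
      rw [configOf_squareLatticeEmbedding]
      simp only [z2QuadConfig, inter_eq_left.mpr (show ω ⊆ (zdGraph 2).edgeSet from hω)]
    rw [show (Q ∈ configOf squareLatticeEmbedding.z η univ ω ↔
        Q ∈ z2QuadConfig univ (η * Real.sqrt 2) ω) from by rw [e]]
    exact mem_z2QuadConfig_iff_exists_isCrossing hδ
  constructor
  · -- lower bound: all tubes crossed ⇒ all quads crossed
    have hsub : (⋂ i ∈ (Finset.univ : Finset (Fin m)), T i η) ∩ nnSupport ⊆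
        A m F η ∩ nnSupport := by
      rintro ω ⟨hω, hωN⟩
      refine ⟨fun i => ?_, hωN⟩
      obtain ⟨K, hKQ, hKO⟩ := (hprim i).2.2.2 0 (by simp; positivity) (by simp; positivity) ω
        (mem_iInter₂.1 hω i (Finset.mem_univ _)) hωN
      exact (hcrit ω hωN (F i)).2 ⟨K, hKQ, fun z hz => by simpa using hKO z hz⟩
    calc min (∏ i, c i) c' ≤ ∏ i, c i := min_le_left _ _
      _ ≤ ∏ i, (bondPercolation (zdGraph 2) half).real (T i η) :=
          Finset.prod_le_prod (fun i _ => (hc i).le) fun i _ => (hprim i).2.2.1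
      _ ≤ (bondPercolation (zdGraph 2) half).real (⋂ i ∈ (Finset.univ : Finset (Fin m)), T i η) :=
          real_biInter_ge_prod (zdGraph 2) half _ _ (fun i _ => (hprim i).2.1) fun i _ => (hprim i).1
      _ = (bondPercolation (zdGraph 2) half).real
            ((⋂ i ∈ (Finset.univ : Finset (Fin m)), T i η) ∩ nnSupport) := by
          rw [measureReal_def, measureReal_def, measure_inter_conull hN]
      _ ≤ (bondPercolation (zdGraph 2) half).real (A m F η ∩ nnSupport) := measureReal_mono hsub
      _ = _ := hAloc.symm
  · -- upper bound: a dual tube of the transposed first quad blocks every open crossing of `F 0`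
    set D : Set (BondConfig (Site 2)) := dualConfig ⁻¹' T' η with hD
    have hDm : MeasurableSet D := measurable_dualConfig hT'm
    have hDμ : (bondPercolation (zdGraph 2) half).real D =
        (bondPercolation (zdGraph 2) half).real (T' η) := by
      rw [measureReal_def, measureReal_def, hD, ← Measure.map_apply measurable_dualConfig hT'm,
        bondPercolation_map_dualConfig_holds half,
        show unitInterval.symm half = half from Subtype.ext (by simp [half]; norm_num)]
    have h22 : Real.sqrt 2 ≤ 2 := by
      nlinarith [Real.sq_sqrt (show (0 : ℝ) ≤ 2 by norm_num), Real.sqrt_nonneg 2]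
    have hsh : |(SSContinuity.dualShift (η * Real.sqrt 2)).re| ≤ 2 * η ∧
        |(SSContinuity.dualShift (η * Real.sqrt 2)).im| ≤ 2 * η := by
      have hn := SSContinuity.norm_dualShift_le hδ.le
      exact ⟨(Complex.abs_re_le_norm _).trans (hn.trans (by nlinarith)),
        (Complex.abs_im_le_norm _).trans (hn.trans (by nlinarith))⟩
    have hdisj : A m F η ∩ nnSupport ⊆ Dᶜ := by
      rintro ω ⟨hωA, hωN⟩ hωD
      have hsub' : dualConfig ω ⊆ (zdGraph 2).edgeSet := fun e he => (mem_dualConfig_iff.1 he).1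
      obtain ⟨K, ⟨hKc, hKconn, hKQ, hK1, hK3⟩, hKO⟩ := hK' _ hsh.1 hsh.2 (dualConfig ω) hωD hsub'
      obtain ⟨K₀, ⟨hK₀c, hK₀conn, hK₀Q, ⟨a, haK, ha⟩, ⟨b, hbK, hb⟩⟩, hK₀O⟩ :=
        (hcrit ω hωN (F ⟨0, hm⟩)).1 (hωA ⟨0, hm⟩)
      obtain ⟨π, hπ⟩ := joinedIn_inter_openEdgeUnion_of_isConnected hδ hK₀c hK₀conn hK₀O hK₀Q
        haK hbK
      have hπ' : ∀ u, π.extend u ∈ (F ⟨0, hm⟩).carrier ∩ openEdgeUnion (η * Real.sqrt 2) ω :=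
        fun u => by
          obtain ⟨v, hv⟩ : π.extend u ∈ range π := by rw [← π.extend_range]; exact mem_range_self u
          rw [← hv]; exact hπ v
      obtain ⟨u, -, hu⟩ := (F ⟨0, hm⟩).exists_mem_of_isPreconnected_crossing' hKc
        hKconn.isPreconnected (hcar ▸ hKQ) (ht0 ▸ hK1) (ht2 ▸ hK3) (β := fun u => π.extend u)
        π.continuous_extend.continuousOn (fun u _ => (hπ' u).1) (by simpa using ha)
        (by simpa using hb)
      exact SSContinuity.not_mem_openEdgeUnion_dualConfig_sub hδ (hπ' u).2 (hKO _ hu)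
    calc (bondPercolation (zdGraph 2) half).real (Aloc m F η)
        = (bondPercolation (zdGraph 2) half).real (A m F η ∩ nnSupport) := hAloc
      _ ≤ (bondPercolation (zdGraph 2) half).real Dᶜ := measureReal_mono hdisj
      _ = 1 - (bondPercolation (zdGraph 2) half).real D := by
          rw [measureReal_compl hDm, probReal_univ]
      _ ≤ 1 - min (∏ i, c i) c' := by rw [hDμ]; linarith [min_le_right (∏ i, c i) c', hT'c]

end Summit.CriticalPhenomena.CardyFormulaZ2.Theorems.CardySelfRefinement

end
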